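import Literature.NumberTheory.EllipticCurves.FormalGroupFiniteHeightProofs
import Literature.RingTheory.FormalGroups.HondaTypeFunctionalEquationII
import HarnessLib

/-!
# Formal groups of infinite height: `[n] = nX` for the cuspidal cubic, and the logarithm of a
# Weierstrass curve over `ℤ_p` with `[p] ≡ 0 (mod p)` is `p`-integral (proofs only)

Topic `NumberTheory/EllipticCurves` (theorems only; no definition, no named fact). Sequel of
`FormalGroupFiniteHeightProofs` (finite height at a good prime) and `NodalCubicFormalGroupProofs`
(finite height at a node), treating the remaining, INFINITE-height case — the cusp, i.e. a prime of
additive reduction — in support of the named fact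
`Literature.NumberTheory.EllipticCurves.edixhoven_int_of_neronLattice_eq_smul_periodLattice`
(Edixhoven 1991, Prop. 2: the Manin constant is an integer; see the finite-height route recorded in
`NeronIsogenyScaling.lean` and `ManinConstantGoodPrimesProofs`).

* `formalMul_of_a_eq_zero`: for the cuspidal cubic `y² = x³` (all `aᵢ = 0`) over any ring,
  `[n](X) = nX` — its formal group is the additive group `𝔾̂ₐ` (`η = 1`, `ω₀ = 1`, so
  `[n]' = n` by `ω₀([n])[n]' = nω₀`); hence `[p] = 0` in characteristic `p`
  (`formalMul_eq_zero_of_a_eq_zero_of_charP`): infinite height.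
* `norm_coeff_formalLog_le_one_of_formalMul_prime_eq_zero`: **if `V/ℤ_p` has `[p]_V ≡ 0 (mod p)`
  then `log_V ∈ ℤ_p⟦X⟧`.** Proof: `[p] = p·g` with `g ∈ ℤ_p⟦X⟧`, and `log([p]X) = p·log X`;
  comparing coefficients of `X^N`, `b_N (p − [X^N][p]^N) = Σ_{d<N} b_d [X^N][p]^d ∈ p ℤ_p` by
  induction, while `‖[X^N][p]^N‖ ≤ p^{-N} < ‖p‖`, so `‖b_N‖ ≤ 1`. (Over `ℤ_p`, unramified, this is
  Honda's remark that a formal group of infinite height has type `p`, i.e. is strongly isomorphic to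
  `𝔾̂ₐ`; it fails over ramified rings.)
* `norm_coeff_le_one_of_subst_of_norm_coeff_le_one`: if `ℓ ∈ ℤ_p⟦X⟧` with `‖[X¹]ℓ‖ = 1` and
  `ℓ(ψ) ∈ ℤ_p⟦X⟧`, `ψ(0) = 0`, then `ψ ∈ ℤ_p⟦X⟧` (inverse-function integrality); whence
  `exists_padicInt_formalLog_subst_eq_of_formalMul_prime_eq_zero`: at infinite height every
  `ℓ₂ ∈ Xℤ_p⟦X⟧` is `log_V(ψ)` for a (unique) `ψ ∈ Xℤ_p⟦X⟧` — the "Honda witness" is free.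

## References

* T. Honda, *On the theory of commutative formal groups*, J. Math. Soc. Japan 22 (1970), 213–246,
  §2 (types; a type `≡ 0 mod p` has infinite height), Thm. 2 (p. 223). [Honda1970]
* J. H. Silverman, *The Arithmetic of Elliptic Curves*, 2nd ed. (2009), III.2.5 (`E_ns ≅ 𝔾ₐ` at a
  cusp), IV.2.3, IV.4.3, IV.5.5, IV.7 (height). [SilvermanAEC2009]
-/

noncomputable section

open scoped Classical

namespace WeierstrassCurve

open PowerSeries Literature.NumberTheory.EllipticCurves Literature.RingTheory.FormalGroups

/-! ### The cuspidal cubic `y² = x³`: `[n] = nX` -/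

section Cusp

variable {R : Type*} [CommRing R] (W : WeierstrassCurve R)

/-- For `y² = x³` (all `aᵢ = 0`) the inverse invariant differential is `η = 1`. [Silverman AEC IV.1]
[folklore] -/
theorem formalEta_of_a_eq_zero (h₁ : W.a₁ = 0) (h₂ : W.a₂ = 0) (h₃ : W.a₃ = 0) (h₄ : W.a₄ = 0)
    (h₆ : W.a₆ = 0) : W.formalEta = 1 := by
  rw [formalEta_def, h₁, h₂, h₃, h₄, h₆]
  simp

/-- For `y² = x³` the integral invariant differential is `ω₀ = 1` (`dz`). [Silverman AEC IV.1]
[folklore] -/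
theorem formalInvDiff_of_a_eq_zero (h₁ : W.a₁ = 0) (h₂ : W.a₂ = 0) (h₃ : W.a₃ = 0) (h₄ : W.a₄ = 0)
    (h₆ : W.a₆ = 0) : W.formalInvDiff = 1 := by
  have h := W.formalEta_mul_formalInvDiff
  rwa [W.formalEta_of_a_eq_zero h₁ h₂ h₃ h₄ h₆, one_mul] at h

/-- **`[n](X) = nX` for the cuspidal cubic `y² = x³` over every commutative ring**: its formal
group is `𝔾̂ₐ` (Silverman III.2.5: `E_ns ≅ 𝔾ₐ` at a cusp, `(x, y) ↦ x/y`). Proof over `ℤ` by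
`ω₀([n])·[n]' = n·ω₀` with `ω₀ = 1`, then base change. [cite: SilvermanAEC2009, Prop. III.2.5] -/
theorem formalMul_of_a_eq_zero (h₁ : W.a₁ = 0) (h₂ : W.a₂ = 0) (h₃ : W.a₃ = 0) (h₄ : W.a₄ = 0)
    (h₆ : W.a₆ = 0) (n : ℕ) : W.formalMul n = n • X := by
  -- the universal case `W₀ = (0,0,0,0,0)` over `ℤ`
  set W₀ : WeierstrassCurve ℤ := ⟨0, 0, 0, 0, 0⟩ with hW₀
  have hZ : W₀.formalMul n = n • X := by
    have hω : W₀.formalInvDiff = 1 := W₀.formalInvDiff_of_a_eq_zero rfl rfl rfl rfl rfl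
    have hs : HasSubst (W₀.formalMul n) := W₀.hasSubst_formalMul n
    have h := W₀.formalInvDiff_subst_formalMul_mul_derivative' n
    rw [hω, ← coe_substAlgHom hs, map_one, one_mul] at h
    apply PowerSeries.derivative.ext
    · rw [h, map_nsmul, derivative_X]
    · rw [W₀.constantCoeff_formalMul, map_nsmul, constantCoeff_X, nsmul_zero]
  have hmap : W₀.map (Int.castRingHom R) = W := by
    ext <;> simp [hW₀, WeierstrassCurve.map, h₁, h₂, h₃, h₄, h₆]
  have h := congrArg (PowerSeries.map (Int.castRingHom R)) hZ
  rwa [map_formalMul, hmap, map_nsmul, map_X] at h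

/-- **`[p] = 0` for the cuspidal cubic in characteristic `p`**: the formal group of a cusp has
infinite height. [cite: SilvermanAEC2009, Prop. III.2.5] -/
theorem formalMul_eq_zero_of_a_eq_zero_of_charP (p : ℕ) [CharP R p] (h₁ : W.a₁ = 0) (h₂ : W.a₂ = 0)
    (h₃ : W.a₃ = 0) (h₄ : W.a₄ = 0) (h₆ : W.a₆ = 0) : W.formalMul p = 0 := by
  rw [W.formalMul_of_a_eq_zero h₁ h₂ h₃ h₄ h₆, nsmul_eq_mul, ← map_natCast (C (R := R)) p,
    CharP.cast_eq_zero, map_zero, zero_mul]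

end Cusp

/-! ### Infinite height over `ℤ_p`: the logarithm is integral -/

section InfiniteHeight

variable {p : ℕ} [hp : Fact p.Prime] (V : WeierstrassCurve ℤ_[p])

/-- **If `[p]_V ≡ 0 (mod p)` then `log_V ∈ ℤ_p⟦X⟧`** (`V/ℤ_p`, generic fibre `W = V ⊗ ℚ_p`): at
infinite height the formal logarithm has `p`-integral coefficients (Honda: over the unramified ring
`ℤ_p` a formal group whose reduction has infinite height is of type `p`, i.e. strongly isomorphic to
`𝔾̂ₐ`). Proof: `[p] = p·g`, `g ∈ ℤ_p⟦X⟧`, and `log([p]) = p·log`; the coefficient of `X^N` gives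
`p·b_N = Σ_{d ≤ N} b_d [X^N][p]^d` with `‖[X^N][p]^d‖ ≤ p^{-d}`, whence `‖b_N‖ ≤ 1` by induction.
[cite: Honda1970, Thm. 2 (p. 223)] -/
theorem norm_coeff_formalLog_le_one_of_formalMul_prime_eq_zero
    (h0 : (V.map PadicInt.toZMod).formalMul p = 0) (n : ℕ) :
    ‖coeff n (V.map PadicInt.Coe.ringHom).formalLog‖ ≤ 1 := by
  set W := V.map PadicInt.Coe.ringHom with hWdef
  have hp1 : (1 : ℝ) < p := by exact_mod_cast hp.out.one_lt
  have hp0 : (0 : ℝ) < p := by positivity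
  have hpinv1 : (p : ℝ)⁻¹ ≤ 1 := inv_le_one_of_one_le₀ hp1.le
  have hpinv0 : (0 : ℝ) ≤ (p : ℝ)⁻¹ := by positivity
  have hpQ : (p : ℚ_[p]) ≠ 0 := by exact_mod_cast hp.out.ne_zero
  -- `u = [p]_W`, every coefficient of norm `≤ p⁻¹`; `u = p · g` with `g` integral
  have hV : PowerSeries.map PadicInt.toZMod (V.formalMul p) = 0 := by rw [map_formalMul, h0]
  set u : ℚ_[p]⟦X⟧ := (V.formalMul p).map PadicInt.Coe.ringHom with hu
  have hu' : u = W.formalMul p := by rw [hu, map_formalMul]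
  have hu0 : constantCoeff u = 0 := by rw [hu', W.constantCoeff_formalMul]
  have huv : ∀ m, ‖coeff m u‖ ≤ (p : ℝ)⁻¹ := fun m ↦ by
    rw [hu]; exact norm_coeff_map_le_inv_of_map_toZMod hV m
  set g : ℚ_[p]⟦X⟧ := C (p : ℚ_[p])⁻¹ * u with hg
  have hug : u = C (p : ℚ_[p]) * g := by
    rw [hg, ← mul_assoc, ← map_mul, mul_inv_cancel₀ hpQ, map_one, one_mul]
  have hgI : IsPadicInt g := by
    refine isPadicInt_iff_coeff.mpr fun m ↦ ?_
    rw [hg, coeff_C_mul, norm_mul, norm_inv, Padic.norm_p, inv_inv]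
    calc (p : ℝ) * ‖coeff m u‖ ≤ p * (p : ℝ)⁻¹ := by gcongr; exact huv m
      _ = 1 := mul_inv_cancel₀ hp0.ne'
  have hud : ∀ d N, ‖coeff N (u ^ d)‖ ≤ (p : ℝ)⁻¹ ^ d := fun d N ↦ by
    rw [hug, mul_pow, ← map_pow, coeff_C_mul, norm_mul, norm_pow, Padic.norm_p]
    calc (p : ℝ)⁻¹ ^ d * ‖coeff N (g ^ d)‖ ≤ (p : ℝ)⁻¹ ^ d * 1 := by
          gcongr; exact isPadicInt_iff_coeff.mp (hgI.pow d) N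
      _ = (p : ℝ)⁻¹ ^ d := mul_one _
  -- `log(u) = p • log`
  have hlog : W.formalLog.subst u = p • W.formalLog := by
    rw [hu']; exact W.formalLog_subst_formalMul_rat p
  induction n using Nat.strong_induction_on with
  | _ N ih =>
    rcases Nat.lt_or_ge N 2 with hN | hN
    · interval_cases N
      · rw [coeff_zero_eq_constantCoeff_apply, W.constantCoeff_formalLog, norm_zero]
        exact zero_le_one
      · rw [W.coeff_one_formalLog, norm_one]
    set b : ℕ → ℚ_[p] := fun k ↦ coeff k W.formalLog with hb
    have key := congrArg (coeff N) hlog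
    rw [coeff_subst_eq_sum hu0, Finset.sum_range_succ, map_nsmul, nsmul_eq_mul] at key
    -- `key : Σ_{d<N} b_d [X^N]u^d + b_N [X^N]u^N = p b_N`
    have hrest : ‖∑ d ∈ Finset.range N, coeff d W.formalLog * coeff N (u ^ d)‖ ≤ (p : ℝ)⁻¹ := by
      refine IsUltrametricDist.norm_sum_le_of_forall_le_of_nonneg hpinv0 fun d hd ↦ ?_
      rw [Finset.mem_range] at hd
      rcases Nat.eq_zero_or_pos d with rfl | hd0
      · rw [pow_zero, coeff_one, if_neg (by omega), mul_zero, norm_zero]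
        exact hpinv0
      · rw [norm_mul]
        calc ‖coeff d W.formalLog‖ * ‖coeff N (u ^ d)‖ ≤ 1 * (p : ℝ)⁻¹ ^ d := by
              gcongr
              · exact ih d hd
              · exact hud d N
          _ ≤ (p : ℝ)⁻¹ ^ 1 := by
              rw [one_mul]; exact pow_le_pow_of_le_one hpinv0 hpinv1 hd0
          _ = (p : ℝ)⁻¹ := pow_one _
    by_contra hcon
    rw [not_le] at hcon
    -- `‖b_N‖ · p⁻¹ = ‖p b_N − b_N [X^N]u^N‖ ≤ max (p⁻¹) (‖b_N‖ p^{-N}) < ‖b_N‖ p⁻¹`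
    have h1 : (p : ℚ_[p]) * coeff N W.formalLog - coeff N W.formalLog * coeff N (u ^ N) =
        ∑ d ∈ Finset.range N, coeff d W.formalLog * coeff N (u ^ d) := by
      rw [← key]; ring
    have h2 : ‖(p : ℚ_[p]) * coeff N W.formalLog‖ = (p : ℝ)⁻¹ * ‖coeff N W.formalLog‖ := by
      rw [norm_mul, Padic.norm_p]
    have h3 : ‖coeff N W.formalLog * coeff N (u ^ N)‖ < (p : ℝ)⁻¹ * ‖coeff N W.formalLog‖ := by
      rw [norm_mul, mul_comm]
      have hlt : ‖coeff N (u ^ N)‖ < (p : ℝ)⁻¹ := by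
        calc ‖coeff N (u ^ N)‖ ≤ (p : ℝ)⁻¹ ^ N := hud N N
          _ < (p : ℝ)⁻¹ ^ 1 :=
              pow_lt_pow_right_of_lt_one₀ (by positivity) (inv_lt_one_of_one_lt₀ hp1) (by omega)
          _ = (p : ℝ)⁻¹ := pow_one _
      exact mul_lt_mul_of_pos_right hlt (by linarith)
    have h4 : (p : ℝ)⁻¹ < (p : ℝ)⁻¹ * ‖coeff N W.formalLog‖ :=
      lt_mul_of_one_lt_right (by positivity) hcon
    have h5 : ‖(p : ℚ_[p]) * coeff N W.formalLog‖ ≤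
        max ‖(p : ℚ_[p]) * coeff N W.formalLog - coeff N W.formalLog * coeff N (u ^ N)‖
          ‖coeff N W.formalLog * coeff N (u ^ N)‖ := by
      have e : (p : ℚ_[p]) * coeff N W.formalLog =
          ((p : ℚ_[p]) * coeff N W.formalLog - coeff N W.formalLog * coeff N (u ^ N)) +
            coeff N W.formalLog * coeff N (u ^ N) := by ring
      conv_lhs => rw [e]
      exact IsUltrametricDist.norm_add_le_max _ _
    rw [h1, h2] at h5
    have h6 : max ‖∑ d ∈ Finset.range N, coeff d W.formalLog * coeff N (u ^ d)‖
        ‖coeff N W.formalLog * coeff N (u ^ N)‖ < (p : ℝ)⁻¹ * ‖coeff N W.formalLog‖ :=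
      max_lt (lt_of_le_of_lt hrest h4) h3
    exact absurd h5 (not_le.mpr h6)

/-- The same, as `IsPadicInt log_W`. [cite: Honda1970, Thm. 2 (p. 223)] -/
theorem isPadicInt_formalLog_of_formalMul_prime_eq_zero
    (h0 : (V.map PadicInt.toZMod).formalMul p = 0) :
    IsPadicInt (V.map PadicInt.Coe.ringHom).formalLog :=
  isPadicInt_iff_coeff.mpr (V.norm_coeff_formalLog_le_one_of_formalMul_prime_eq_zero h0)

end InfiniteHeight

/-! ### Inverse-function integrality and the free Honda witness at infinite height -/

section Inverse

variable {p : ℕ} [hp : Fact p.Prime]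

/-- **Inverse-function integrality**: if `ℓ ∈ ℤ_p⟦X⟧` has `‖[X¹]ℓ‖ = 1` and `ψ ∈ Xℚ_p⟦X⟧` is such
that `ℓ(ψ) ∈ ℤ_p⟦X⟧`, then `ψ ∈ ℤ_p⟦X⟧` (compare the coefficients of `Xⁿ` of `ℓ(ψ)` and
`ℓ(ψ_{<n})`: they differ by `[X¹]ℓ · [Xⁿ]ψ`). In particular the compositional inverse of such an
`ℓ` is integral. [folklore] -/
theorem _root_.Literature.NumberTheory.EllipticCurves.norm_coeff_le_one_of_subst_of_norm_coeff_le_one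
    {ℓ : ℚ_[p]⟦X⟧} (hℓ : ∀ n, ‖coeff n ℓ‖ ≤ 1) (h1 : ‖coeff 1 ℓ‖ = 1) {ψ : ℚ_[p]⟦X⟧}
    (hψ0 : constantCoeff ψ = 0) (hℓψ : ∀ n, ‖coeff n (ℓ.subst ψ)‖ ≤ 1) (n : ℕ) :
    ‖coeff n ψ‖ ≤ 1 := by
  induction n using Nat.strong_induction_on with
  | _ n ih =>
    rcases Nat.eq_zero_or_pos n with rfl | hn
    · rw [coeff_zero_eq_constantCoeff_apply, hψ0, norm_zero]; exact zero_le_one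
    set ψn : ℚ_[p]⟦X⟧ := (trunc n ψ : ℚ_[p]⟦X⟧) with hψn
    have hψn0 : constantCoeff ψn = 0 := by
      rw [hψn, ← coeff_zero_eq_constantCoeff_apply, Polynomial.coeff_coe, coeff_trunc, if_pos hn,
        coeff_zero_eq_constantCoeff_apply, hψ0]
    have hψnint : ∀ m, ‖coeff m ψn‖ ≤ 1 := fun m ↦ by
      rw [hψn, Polynomial.coeff_coe, coeff_trunc]
      split_ifs with hm
      · exact ih m hm
      · rw [norm_zero]; exact zero_le_one
    have hψnI : IsPadicInt ψn := isPadicInt_iff_coeff.mpr hψnint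
    have hℓI : IsPadicInt ℓ := isPadicInt_iff_coeff.mpr hℓ
    have hsub : ∀ m, ‖coeff m (ℓ.subst ψn)‖ ≤ 1 :=
      isPadicInt_iff_coeff.mp (hℓI.powerSeries_subst hψnI (HasSubst.of_constantCoeff_zero' hψn0))
    have hdvd : (X : ℚ_[p]⟦X⟧) ^ n ∣ ψ - ψn := X_pow_dvd_sub_trunc ψ n
    have hD : ∀ m, ‖coeff m (ℓ.subst ψ - ℓ.subst ψn)‖ ≤ 1 := norm_coeff_sub_le hℓψ hsub
    have hDn := hD n
    rw [coeff_subst_sub_subst_eq_of_X_pow_dvd_sub ℓ hn hdvd hψ0 hψn0, map_sub, hψn,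
      Polynomial.coeff_coe, coeff_trunc, if_neg (lt_irrefl n), sub_zero, norm_mul, h1, one_mul] at hDn
    exact hDn

variable (V : WeierstrassCurve ℤ_[p])

/-- **At infinite height `exp_W` is integral**: if `[p]_V ≡ 0 (mod p)` then
`exp_W = log_W⁻¹ ∈ ℤ_p⟦X⟧`. [cite: Honda1970, Thm. 2 (p. 223)] -/
theorem norm_coeff_formalExp_le_one_of_formalMul_prime_eq_zero
    (h0 : (V.map PadicInt.toZMod).formalMul p = 0) (n : ℕ) :
    ‖coeff n (V.map PadicInt.Coe.ringHom).formalExp‖ ≤ 1 := by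
  set W := V.map PadicInt.Coe.ringHom
  refine norm_coeff_le_one_of_subst_of_norm_coeff_le_one
    (V.norm_coeff_formalLog_le_one_of_formalMul_prime_eq_zero h0)
    (by rw [W.coeff_one_formalLog, norm_one]) W.constantCoeff_formalExp (fun m ↦ ?_) n
  rw [W.formalLog_subst_formalExp, coeff_X]
  split_ifs
  · rw [norm_one]
  · rw [norm_zero]; exact zero_le_one

/-- **The Honda witness is free at infinite height**: if `[p]_V ≡ 0 (mod p)`, then for every
`ℓ₂ ∈ Xℤ_p⟦X⟧` there is `ψ ∈ Xℤ_p⟦X⟧` with `log_W(ψ) = ℓ₂` (namely `ψ = exp_W(ℓ₂)`).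
[cite: Honda1970, Thm. 2 (p. 223)] -/
theorem exists_padicInt_formalLog_subst_eq_of_formalMul_prime_eq_zero
    (h0 : (V.map PadicInt.toZMod).formalMul p = 0) {ℓ₂ : ℚ_[p]⟦X⟧} (hℓ0 : constantCoeff ℓ₂ = 0)
    (hℓ : ∀ n, ‖coeff n ℓ₂‖ ≤ 1) :
    ∃ ψ : ℚ_[p]⟦X⟧, constantCoeff ψ = 0 ∧ (∀ n, ‖coeff n ψ‖ ≤ 1) ∧
      (V.map PadicInt.Coe.ringHom).formalLog.subst ψ = ℓ₂ := by
  set W := V.map PadicInt.Coe.ringHom with hW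
  have hℓs : HasSubst ℓ₂ := HasSubst.of_constantCoeff_zero' hℓ0
  set ψ : ℚ_[p]⟦X⟧ := W.formalExp.subst ℓ₂ with hψ
  have hψ0 : constantCoeff ψ = 0 :=
    (Literature.NumberTheory.EllipticCurves.constantCoeff_subst_of_constantCoeff_eq_zero hℓ0).trans
      W.constantCoeff_formalExp
  have hlog : W.formalLog.subst ψ = ℓ₂ := by
    rw [hψ, ← subst_comp_subst_apply (HasSubst.of_constantCoeff_zero' W.constantCoeff_formalExp) hℓs,
      W.formalLog_subst_formalExp, subst_X hℓs]
  refine ⟨ψ, hψ0, fun n ↦ ?_, hlog⟩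
  have hexpI : IsPadicInt W.formalExp :=
    isPadicInt_iff_coeff.mpr (V.norm_coeff_formalExp_le_one_of_formalMul_prime_eq_zero h0)
  exact isPadicInt_iff_coeff.mp
    (hexpI.powerSeries_subst (isPadicInt_iff_coeff.mpr hℓ) hℓs) n

end Inverse

end WeierstrassCurve
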